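import Summits.HodgeConjecture.HodgeConjecture.Theorems.F0P3cStCharTSUpValue          -- ★ p850986 (this seat) «UP-VALUE★»: `χ_ρ^G(z·𝓘.aᵐ) = δ_B^{1/2}·χ_{ξ,μ}` at every deep diagonal point; brings ★ XIGAssembly (the (S-X)′ cone)
import Summits.HodgeConjecture.HodgeConjecture.Theorems.F0P3cStCharTSDecSigma          -- ★ p850924 (LH6-p05): `shellDecay_of_dominant_half` (the `ω`-half), `unitModulusChar_reflect_fst`; brings ★ L1MSplit `unitModulusChar_ne_zero`
import Summits.HodgeConjecture.HodgeConjecture.Theorems.F0P3CMBorelIwahoriDatum         -- ★ (F0P3-p01∕T1): `exists_cmIwahoriDatum` (a datum ALONG ANY contracting ray), `placeForm_qsForm_eq`, `galAdicCompletionMap_involutive`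
import Summits.HodgeConjecture.HodgeConjecture.Theorems.F0P2oBorelTorusModulus          -- ★ (F0P2 line): `rootDeltaChar_cmBorel_torus` — `δ_B^{1/2}(d(α, β, ᾱ⁻¹)) = ‖α‖`
import Summits.HodgeConjecture.HodgeConjecture.Theorems.F0P3cStCharTSDomBridge          -- ★ (A-p16): `coe_localNonsplitEquiv_torusChart` — the model matrix of `ι m`
import Literature.NumberTheory.Automorphic.UnitaryGroupRankOneTorusGeneration             -- ★ (LH6-p02): `exists_coe_eq_diag_of_mem_torusU` (model torus elements are `d(d₀, β, (σd₀)⁻¹)`); brings ★ BigCell `exists_coe_eq_diag`, `exists_coe_eq_scalar_mem_center`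
import Literature.NumberTheory.Automorphic.UnitaryGroupRankOneCartanAnyInvolution         -- ★ `mem_torusU_of_coe_eq_diagonal`
import Literature.NumberTheory.Automorphic.CMLocalNonsplitBorelTransport                  -- ★ `localNonsplitEquiv_mem_torusU_iff`
import Literature.NumberTheory.Automorphic.CMXiTorusCharSplitTorusDecay                   -- ★ `cmXiTorusChar_apply`, `unitModulusChar_lt_one_of_forall_v_lt_one`
import Literature.NumberTheory.Automorphic.TorusCharacterLocalComponents                  -- ★ `cm_norm_torusLocalComponent_eq_one` (automorphic ⇒ unitary), `semilocalComponent_apply`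
import Literature.NumberTheory.Rogawski1990.Ch12Sec5UpSpecLB                              -- ★ p852414 (F0P3-p02 g23): `EllipticData.UpSpecLB` (ED. 2, the `_LB` twin §4)
import HarnessLib

/-!
# F0 · P3c · line LH6 «StCharTS» — road (L1M-up), «DEC-UP★»: THE SHELL DECAY (DEC-up) OF `D_G·χ_ρ^G` ALONG THE SPLIT TORUS, `ρ = {St_H(ξ_v)}` —
# the fourth clause of the (TOR⁶) block of the (S-𝔇) organ, PAID with `C = 1`, `s = 1∕2` [Rogawski1990, §12.7 Lemma 12.7.2 (proof) p. 193; §12.5 Lemma 12.5.1 p. 183]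

Cell `pub/hodgecm-mathlib`, crux H413 = `stmt-HodgeConjecture-24833` (lane `--supports … --as helper`), route HCCMUnconditional; seat F0P2-p06 (g16),
desk F0P3-plan (g15) deal 2026-09-02T09:14:52Z «(L1M-up) ROAD» (census 09:20:33Z, brick 1 ★ p850986 «UP-VALUE★»; integrator LH6-p01 (g3), heads ₈∕₉, leaf
`Cruxes/H413/Lines/F0_P3c_StCharTSPaydown.lean` ED. 12 (S-𝔇) :304–305).  THEOREMS ONLY (no definition, no instance, no notation, no named fact, no `sorry`);
★-only imports.  HONEST LABEL: HC_CM is proved only modulo the 7 printed citations (2 remaining: hLiu418 = stmt-HodgeConjecture-24832, h413 = stmt-HodgeConjecture-24833)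
until rung 0 closes; count-neutral until the integrator's edition folds this file ((DEC-up) DERIVED; (HCB-up) stays the one print-deep socket of the block, desk 09:22:41Z shape (A)).

THE MATHEMATICS.  `G = U(Φ₃)(L⁺_v)` (`v` non-split, `w ∣ v`), `M = E_vˣ × E¹_v` with chart `ι` (★ `torusChart`), `M_c = 𝒪ˣ × E¹`, `Δ = ` ★ `vanDijkWeight` (`= max(‖α‖, ‖α‖⁻¹)`
off `M_c`, ★ `vanDijkWeight_torusChart_of_not_mem`), `χ_ρ^G = 𝔇.up (𝔇.packetCharH {πSt})`.  Print (p. 193, via L. 12.5.1 p. 183 and Prop. 4.9.1): on the split torus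
`D_G χ_ρ^G = τ·D_H·χ_ρ = ξ(γ)μ(α)‖α‖^{1/2}`, so `|D_G χ_ρ^G(ι(α, z))| = ‖α‖^{1/2} = min(‖α‖, ‖α‖⁻¹)^{1/2}` off `M_c`.  HERE: (§1, model) every `t = d(d₀, β, (σd₀)⁻¹)` of the
diagonal torus of `U(σ, Φ₃)(K)` is `(β·1)·d(α, 1, (σα)⁻¹)` with `α = d₀β⁻¹` and `β·1` central (★ `exists_coe_eq_diag_of_mem_torusU`, ★ `exists_coe_eq_scalar_mem_center`,
★ `exists_coe_eq_diag`); (§2) pulled back along the one-place model ★ `localNonsplitEquiv`: a DOMINANT chart point (`|m.1|_w < 1`) is `ι m = z·a` with `z` central and `a` a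
contracting ray `d(α, 1, (σ_w α)⁻¹)`, `0 < |α|_w < 1` — exactly the rays ★ `exists_cmIwahoriDatum` accepts; (§3) at such a point ★ «UP-VALUE★» gives `χ_ρ^G(ι m) =
δ_B^{1/2}(ι m)·χ_{ξ,μ}(ι m)`, and `|δ_B^{1/2}(ι m)| = ‖m.1‖` (★ `rootDeltaChar_cmBorel_torus`), `|χ_{ξ,μ}(ι m)| = ‖m.1‖^{1/2}` (★ `cmXiTorusChar_apply`: `ξ.η_v`, `ξ.ψ_v` unitary
since automorphic ★ `cm_norm_torusLocalComponent_eq_one`, `μ_v` unitary by `μ.IsUnitary`, `|‖·‖^{1/2}|`), `Δ(ι m) = ‖m.1‖⁻¹`; so `‖Δ(ι m)·χ_ρ^G(ι m)‖ = ‖m.1‖^{1/2} = 1·min(‖m.1‖,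
‖m.1‖⁻¹)^{1/2}` on the dominant half, and LH6-p05's ★ `ω`-half `shellDecay_of_dominant_half` (class function at regular points: `UpSpec` + COMPAT `hreg`) gives all of `M ∖ M_c`.

## References
* [Rogawski1990] J. D. Rogawski, *Automorphic Representations of Unitary Groups in Three Variables*, Ann. of Math. Stud. 123 (1990): §1.10 p. 9; §4.9 Prop. 4.9.1
  pp. 54–56; §12.2 p. 173; §12.5 Lemma 12.5.1 p. 183; §12.7 Lemma 12.7.2 (proof) p. 193.
* [PlatonovRapinchuk1994] V. Platonov, A. Rapinchuk, *Algebraic Groups and Number Theory* (1994), §2.3, §5.1 (tori of unitary groups; the one-place model).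
-/

set_option autoImplicit false
-- the mandated namespace has the single-problem summit's repeated segment (`HodgeConjecture.HodgeConjecture`)
set_option linter.dupNamespace false

noncomputable section

open NumberField IsDedekindDomain MeasureTheory MeasureTheory.Measure Topology Filter
open scoped Matrix MatrixGroups WithZero Pointwise NNReal
open Literature.NumberTheory Literature.NumberTheory.Automorphic Literature.NumberTheory.Automorphic.UnitaryGroup
open Literature.NumberTheory.GaloisRepresentations
open Literature.NumberTheory.Rogawski1990

namespace Summit.HodgeConjecture.HodgeConjecture.Cruxes.H413.F0P3cStCharTSDecUp

open Summit.HodgeConjecture.HodgeConjecture.Cruxes.H413 Summit.HodgeConjecture.HodgeConjecture.Cruxes.H413.F0P3cStCharTSTorusDefs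

/-! ## §1 (model `U(σ, Φ₃)(K)`) every diagonal torus element is a CENTRAL SCALAR times a RAY `d(α, 1, (σα)⁻¹)` -/

section Model

variable {K : Type*} [Field K] (σ : K →+* K) {J : Matrix (Fin 3) (Fin 3) K} (hJ : J = (StdForm.antidiagonal 3).over K)

include hJ in
/-- **«DOM-RAY» (model).**  For `t ∈ T ≤ U(σ, Φ₃)(K)` with matrix `d(d₀, β, (σd₀)⁻¹)` (★ `exists_coe_eq_diag_of_mem_torusU`): `t = z·r` with `z` CENTRAL (the unitary scalar `β·1`,
★ `exists_coe_eq_scalar_mem_center`), `r ∈ U` with matrix `d(α, 1, (σα)⁻¹)`, `α = d₀β⁻¹ ≠ 0` (★ `exists_coe_eq_diag`), and `t₀₀ = β·α`, `σβ·β = 1`.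
[cite: Rogawski1990, §1.10 p. 9] [cite: PlatonovRapinchuk1994, §2.3] -/
theorem exists_central_mul_ray_of_mem_torusU (hσσ : ∀ x, σ (σ x) = x) {t : ↥(unitaryGroupOfForm σ J)} (ht : t ∈ torusU σ J) :
    ∃ (z r : ↥(unitaryGroupOfForm σ J)) (β α : K),
      z ∈ Subgroup.center ↥(unitaryGroupOfForm σ J) ∧ σ β * β = 1 ∧ α ≠ 0 ∧
      ((r : GL (Fin 3) K) : Matrix (Fin 3) (Fin 3) K) = Matrix.diagonal ![α, 1, (σ α)⁻¹] ∧
      ((t : GL (Fin 3) K) : Matrix (Fin 3) (Fin 3) K) 0 0 = β * α ∧ t = z * r := by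
  obtain ⟨d₀, β, hd₀, hβ, htm⟩ := exists_coe_eq_diag_of_mem_torusU σ hJ ht
  have hβ0 : β ≠ 0 := fun h => by rw [h, mul_zero] at hβ; exact zero_ne_one hβ
  have hσβ : σ β = β⁻¹ := eq_inv_of_mul_eq_one_left hβ
  obtain ⟨z, hzc, -, hz⟩ := exists_coe_eq_scalar_mem_center σ hJ hσσ hβ
  have hα : d₀ * β⁻¹ ≠ 0 := mul_ne_zero hd₀ (inv_ne_zero hβ0)
  obtain ⟨r, -, hr⟩ := exists_coe_eq_diag σ hJ hσσ hα (β := (1 : K)) (by rw [map_one, mul_one])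
  have h00 : β * (d₀ * β⁻¹) = d₀ := by rw [mul_comm, inv_mul_cancel_right₀ hβ0]
  refine ⟨z, r, β, d₀ * β⁻¹, hzc, hβ, hα, ?_, ?_, ?_⟩
  · rw [hr]
    ext i j
    fin_cases i <;> fin_cases j <;> simp
  · rw [htm, h00]
    rfl
  · apply Subtype.ext
    apply Units.ext
    rw [Subgroup.coe_mul, Units.val_mul, htm, hz, hr]
    ext i j
    fin_cases i <;> fin_cases j <;> simp [Matrix.mul_apply, Fin.sum_univ_three, h00, hσβ, hβ0]

end Model

/-! ## §2 (CM carrier) a DOMINANT chart point is `z · a` with `z` central and `a` a contracting ray of ★ `exists_cmIwahoriDatum`'s shape -/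

section CM

variable (L : Type) [Field L] [NumberField L] [IsCMField L] (v : HeightOneSpectrum (𝓞 ↥(maximalRealSubfield L)))
  (w : PlacesOver L v) (hw : IsCMField.complexConj L • w.1 = w.1)

include hw in
set_option maxHeartbeats 1600000 in  -- the one-place model vs the CM carrier: long defeq unfoldings of `cmLocalForm`∕`qsForm` (same class as ★ TORUS-GEN)
/-- **«DOM-RAY» (CM).**  At a non-split `v` (`w ∣ v`), a chart point `ι m`, `m = (α₀, z₀)` with `|α₀|_w < 1`, factors as `ι m = z · a` with `z` CENTRAL in `U(Φ₃)(L⁺_v)` and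
`a ∈ T` whose one-place-model matrix is the contracting ray `d(α, 1, (σ_w α)⁻¹)`, `α ≠ 0`, `|α|_w < 1` (indeed `|α|_w = |α₀|_w`) — the rays of ★ `exists_cmIwahoriDatum`.
(§1 on the model ★ `localNonsplitEquiv`, pulled back as in ★ TORUS-GEN `cm_torus_eq_central_mul_ray_mul_ray_inv`.) [cite: Rogawski1990, §1.10 p. 9; §12.2 p. 173]
[cite: PlatonovRapinchuk1994, §5.1] -/
theorem exists_central_mul_ray_eq_torusChart (m : ((LocalRing L v)ˣ × ↥(normOneUnits (conjLocal L (IsCMField.complexConj L) v)))) (hm : Valued.v ((m.1 : LocalRing L v) w) < 1) :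
    ∃ (z : ↥(unitaryGroupOfForm (conjLocal L (IsCMField.complexConj L) v) (cmLocalForm L 3 v))) (a : ↥(torusU (conjLocal L (IsCMField.complexConj L) v) (cmLocalForm L 3 v))) (α : w.1.adicCompletion L),
      z ∈ Subgroup.center ↥(unitaryGroupOfForm (conjLocal L (IsCMField.complexConj L) v) (cmLocalForm L 3 v)) ∧ α ≠ 0 ∧ Valued.v α < 1 ∧
      ((((localNonsplitEquiv (IsCMField.complexConj L) (Rogawski1990.qsForm L) (IsCMField.complexConj_ne_one L) w hw)
          (a : ↥(unitaryGroupOfForm (conjLocal L (IsCMField.complexConj L) v) (cmLocalForm L 3 v))) : ↥(unitaryGroupOfForm (galAdicCompletionMap (L := L) (IsCMField.complexConj L) hw) (placeForm (Rogawski1990.qsForm L) w.1))) :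
          GL (Fin 3) (w.1.adicCompletion L)) : Matrix (Fin 3) (Fin 3) (w.1.adicCompletion L)) =
        Matrix.diagonal ![α, 1, ((galAdicCompletionMap (L := L) (IsCMField.complexConj L) hw) α)⁻¹] ∧
      ((torusChart L v m : ↥(cmBorelTriple L 3 v).M) : ↥(unitaryGroupOfForm (conjLocal L (IsCMField.complexConj L) v) (cmLocalForm L 3 v))) = z * (a : ↥(unitaryGroupOfForm (conjLocal L (IsCMField.complexConj L) v) (cmLocalForm L 3 v))) := by
  set e : ↥(unitaryGroupOfForm (conjLocal L (IsCMField.complexConj L) v) (cmLocalForm L 3 v)) ≃ₜ* ↥(unitaryGroupOfForm (galAdicCompletionMap (L := L) (IsCMField.complexConj L) hw) (placeForm (Rogawski1990.qsForm L) w.1)) :=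
    localNonsplitEquiv (IsCMField.complexConj L) (Rogawski1990.qsForm L) (IsCMField.complexConj_ne_one L) w hw with he
  have hJw := F0P3CMBorelIwahoriDatum.placeForm_qsForm_eq L v w
  have hσσ : ∀ x, (galAdicCompletionMap (L := L) (IsCMField.complexConj L) hw) ((galAdicCompletionMap (L := L) (IsCMField.complexConj L) hw) x) = x :=
    fun x => F0P3CMBorelIwahoriDatum.galAdicCompletionMap_involutive L v w hw x
  -- `e (ι m) ∈ T′` and the model factorisation (§1)
  have ht' : e ((torusChart L v m : ↥(cmBorelTriple L 3 v).M) : ↥(unitaryGroupOfForm (conjLocal L (IsCMField.complexConj L) v) (cmLocalForm L 3 v))) ∈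
      torusU (galAdicCompletionMap (L := L) (IsCMField.complexConj L) hw) (placeForm (Rogawski1990.qsForm L) w.1) :=
    (localNonsplitEquiv_mem_torusU_iff L v w hw _).2 (torusChart L v m).2
  obtain ⟨z', r', β, α, hz'c, hβ, hα0, hr', h00, hdec⟩ :=
    exists_central_mul_ray_of_mem_torusU (galAdicCompletionMap (L := L) (IsCMField.complexConj L) hw) hJw hσσ ht'
  -- pull back along `e`
  have hr'T : e (e.symm r') ∈ torusU (galAdicCompletionMap (L := L) (IsCMField.complexConj L) hw) (placeForm (Rogawski1990.qsForm L) w.1) := by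
    rw [ContinuousMulEquiv.apply_symm_apply]
    exact mem_torusU_of_coe_eq_diagonal _ hJw hσσ hα0 r' hr'
  have haT : e.symm r' ∈ (cmBorelTriple L 3 v).M := (localNonsplitEquiv_mem_torusU_iff L v w hw _).1 hr'T
  have hzc : e.symm z' ∈ Subgroup.center ↥(unitaryGroupOfForm (conjLocal L (IsCMField.complexConj L) v) (cmLocalForm L 3 v)) := by
    refine Subgroup.mem_center_iff.2 fun g => e.injective ?_
    rw [map_mul, map_mul, ContinuousMulEquiv.apply_symm_apply]
    exact Subgroup.mem_center_iff.1 hz'c (e g)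
  -- valuations: `|β|_w = 1` (unitary scalar, ★ OffStratumG), `β·α = (e (ι m))₀₀ = (m.1)_w` (★ DOM-BRIDGE), so `|α|_w = |m.1|_w < 1`
  have hvβ : Valued.v β = 1 :=
    F0P3cStCharTSOffStratumG.valuation_eq_one_of_map_mul_self Valued.v (galAdicCompletionMap (L := L) (IsCMField.complexConj L) hw)
      (fun x => valued_galAdicCompletionMap (L := L) (IsCMField.complexConj L) hw x) hβ
  have h00' : (((e ((torusChart L v m : ↥(cmBorelTriple L 3 v).M) : ↥(unitaryGroupOfForm (conjLocal L (IsCMField.complexConj L) v) (cmLocalForm L 3 v))) :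
        ↥(unitaryGroupOfForm (galAdicCompletionMap (L := L) (IsCMField.complexConj L) hw) (placeForm (Rogawski1990.qsForm L) w.1))) :
        GL (Fin 3) (w.1.adicCompletion L)) : Matrix (Fin 3) (Fin 3) (w.1.adicCompletion L)) 0 0 = (m.1 : LocalRing L v) w := by
    have h := congrFun (congrFun (F0P3cStCharTSDomBridge.coe_localNonsplitEquiv_torusChart L v w hw m) 0) 0
    rw [Matrix.diagonal_apply_eq] at h
    exact h
  have hvα : Valued.v α = Valued.v ((m.1 : LocalRing L v) w) := by
    have h := congrArg Valued.v h00
    rw [h00', map_mul, hvβ, one_mul] at h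
    exact h.symm
  refine ⟨e.symm z', ⟨e.symm r', haT⟩, α, hzc, hα0, (by rw [hvα]; exact hm), ?_, ?_⟩
  · show ((((e (e.symm r')) : ↥(unitaryGroupOfForm (galAdicCompletionMap (L := L) (IsCMField.complexConj L) hw) (placeForm (Rogawski1990.qsForm L) w.1))) :
        GL (Fin 3) (w.1.adicCompletion L)) : Matrix (Fin 3) (Fin 3) (w.1.adicCompletion L)) = _
    rw [ContinuousMulEquiv.apply_symm_apply]
    exact hr'
  · apply e.injective
    rw [map_mul, ContinuousMulEquiv.apply_symm_apply, ContinuousMulEquiv.apply_symm_apply]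
    exact hdec

end CM

/-! ## §3 (DEC-up) of the (TOR⁶) block, PAID: `‖Δ(ι m)·χ_ρ^G(ι m)‖ ≤ 1 · min(‖m.1‖, ‖m.1‖⁻¹)^{1/2}` off `M_c` -/

set_option maxHeartbeats 16000000 in
set_option synthInstance.maxHeartbeats 400000 in
-- the statement's binders (the organ prefix + the datum block) and the cross-spelling `exact`s (measured class, as ★ UP-VALUE ∕ ★ DEC-SIGMA)
/-- **«DEC-UP★» — the (DEC-up) clause of the (TOR⁶) block of the (S-𝔇) organ `stub_EllipticPackage` of `Cruxes/H413/Lines/F0_P3c_StCharTSPaydown.lean`, BYTE FOR BYTE,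
with the witnesses `C = 1`, `s = 1∕2`.**  Binders: ★ UP-VALUE's prefix (= the (S-X)′ organ's) and datum block (`𝔇`, COMPAT `hμG hμH hreg hTr hρ`, `UpSpec`, (M1H), (UPR)).
Print: «Similarly … `D_H(γ)χ_ρ(γ) = ξ(γ)‖α‖^{1/2}` … the restriction of `D_H(γ)χ_ρ` to `M` is integrable» [L. 12.7.2 (proof) p. 193] transported by [L. 12.5.1 p. 183] — its decay half,
here from ★ UP-VALUE (the transfer identity `UpSpec` + the ★ fundamental-lemma values (S-X)′, no Lemma 12.5.1), §2 «DOM-RAY», ★ `exists_cmIwahoriDatum`, the norms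
★ `rootDeltaChar_cmBorel_torus` ∕ ★ `cmXiTorusChar_apply` ∕ ★ `cm_norm_torusLocalComponent_eq_one` ∕ `μ.IsUnitary`, ★ `vanDijkWeight_torusChart_of_not_mem`, and LH6-p05's ★ `ω`-half
`shellDecay_of_dominant_half` (class function at regular points ⟸ `UpSpec` + COMPAT `hreg`). [cite: Rogawski1990, §12.7 Lemma 12.7.2 (proof) p. 193; §12.5 Lemma 12.5.1 p. 183; §12.2 p. 173] -/
theorem decUp_of_package :
      ∀ (L : Type) [Field L] [NumberField L] [IsCMField L] (μ : HeckeCharacter L) (ξ : OneDimAutRepH L) (v : HeightOneSpectrum (𝓞 ↥(maximalRealSubfield L))),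
        (∀ w : PlacesOver L v, IsCMField.complexConj L • w.1 = w.1) → μ.IsUnitary →
        (∀ x : Literature.NumberTheory.GaloisRepresentations.ideleGroup ↥(maximalRealSubfield L),
          μ (AdeleRing.ideleBaseChange (↥(maximalRealSubfield L)) L x) = quadraticHeckeCharCM L x) →
        ∀ [MeasurableSpace (((UnitaryGroup.cmDatum L 2 (Matrix.of fun i j : Fin 2 => if i.val + j.val + 1 = 2 then (1 : L) else 0)).Local v × (UnitaryGroup.cmDatum L 1 (Matrix.of fun i j : Fin 1 => if i.val + j.val + 1 = 1 then (1 : L) else 0)).Local v))] [BorelSpace (((UnitaryGroup.cmDatum L 2 (Matrix.of fun i j : Fin 2 => if i.val + j.val + 1 = 2 then (1 : L) else 0)).Local v × (UnitaryGroup.cmDatum L 1 (Matrix.of fun i j : Fin 1 => if i.val + j.val + 1 = 1 then (1 : L) else 0)).Local v))] [MeasurableSpace (Gqs L v)] [BorelSpace (Gqs L v)]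
          (νHv : Measure (((UnitaryGroup.cmDatum L 2 (Matrix.of fun i j : Fin 2 => if i.val + j.val + 1 = 2 then (1 : L) else 0)).Local v × (UnitaryGroup.cmDatum L 1 (Matrix.of fun i j : Fin 1 => if i.val + j.val + 1 = 1 then (1 : L) else 0)).Local v))) (νQv : Measure (Gqs L v))
          [νHv.IsHaarMeasure] [νHv.IsMulRightInvariant] [νQv.IsHaarMeasure] [νQv.IsMulRightInvariant],
        letI : ∀ a : ((UnitaryGroup.cmDatum L 2 (Matrix.of fun i j : Fin 2 => if i.val + j.val + 1 = 2 then (1 : L) else 0)).Local v × (UnitaryGroup.cmDatum L 1 (Matrix.of fun i j : Fin 1 => if i.val + j.val + 1 = 1 then (1 : L) else 0)).Local v), MeasurableSpace (((UnitaryGroup.cmDatum L 2 (Matrix.of fun i j : Fin 2 => if i.val + j.val + 1 = 2 then (1 : L) else 0)).Local v × (UnitaryGroup.cmDatum L 1 (Matrix.of fun i j : Fin 1 => if i.val + j.val + 1 = 1 then (1 : L) else 0)).Local v) ⧸ Subgroup.centralizer ({a} : Set (((UnitaryGroup.cmDatum L 2 (Matrix.of fun i j : Fin 2 => if i.val + j.val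 + 1 = 2 then (1 : L) else 0)).Local v × (UnitaryGroup.cmDatum L 1 (Matrix.of fun i j : Fin 1 => if i.val + j.val + 1 = 1 then (1 : L) else 0)).Local v)))) := fun _ => borel _
        haveI : ∀ a : ((UnitaryGroup.cmDatum L 2 (Matrix.of fun i j : Fin 2 => if i.val + j.val + 1 = 2 then (1 : L) else 0)).Local v × (UnitaryGroup.cmDatum L 1 (Matrix.of fun i j : Fin 1 => if i.val + j.val + 1 = 1 then (1 : L) else 0)).Local v), BorelSpace (((UnitaryGroup.cmDatum L 2 (Matrix.of fun i j : Fin 2 => if i.val + j.val + 1 = 2 then (1 : L) else 0)).Local v × (UnitaryGroup.cmDatum L 1 (Matrix.of fun i j : Fin 1 => if i.val + j.val + 1 = 1 then (1 : L) else 0)).Local v) ⧸ Subgroup.centralizer ({a} : Set (((UnitaryGroup.cmDatum L 2 (Matrix.of fun i j : Fin 2 => if i.val + j.val + 1 = 2 then (1 : L) else 0)).Local v × (UnitaryGroup.cmDatum L 1 (Matrix.of fun i j : Fin 1 => if i.val + j.val + 1 = 1 then (1 : L) else 0)).Local v)))) := fun _ => ⟨rfl⟩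
        letI : ∀ γ : Gqs L v, MeasurableSpace (Gqs L v ⧸ Subgroup.centralizer ({γ} : Set (Gqs L v))) := fun _ => borel _
        haveI : ∀ γ : Gqs L v, BorelSpace (Gqs L v ⧸ Subgroup.centralizer ({γ} : Set (Gqs L v))) := fun _ => ⟨rfl⟩
        ∀ (mHv : OrbitalMeasureFamily (((UnitaryGroup.cmDatum L 2 (Matrix.of fun i j : Fin 2 => if i.val + j.val + 1 = 2 then (1 : L) else 0)).Local v × (UnitaryGroup.cmDatum L 1 (Matrix.of fun i j : Fin 1 => if i.val + j.val + 1 = 1 then (1 : L) else 0)).Local v))) (mQv : OrbitalMeasureFamily (Gqs L v)),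
          mHv.IsCanonical (IsLocalGRegular L v) νHv →
          mQv.IsCanonical (fun γ => IsRegularElt (γ.val : GL (Fin 3) (UnitaryGroup.LocalRing L v))) νQv →
          IsLocalDeltaTransferExists L (qsForm L) v ((finExplicitCollection L (qsForm L) μ (finExplicitDelta_conj_left_all L (qsForm L) μ) (finExplicitDelta_conj_right_all L (qsForm L) μ)) v) mHv mQv IsLocSmooth IsLocSmooth →
          ∀ (π₁ πSt : IrrClass (((UnitaryGroup.cmDatum L 2 (Matrix.of fun i j : Fin 2 => if i.val + j.val + 1 = 2 then (1 : L) else 0)).Local v × (UnitaryGroup.cmDatum L 1 (Matrix.of fun i j : Fin 1 => if i.val + j.val + 1 = 1 then (1 : L) else 0)).Local v))),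
            HLengthTwoLabels L v
              (torusCharPair (conjLocal L (IsCMField.complexConj L) v) (cmLocalForm L 2 v) (cmLocalForm_eq_over L 2 v) 0
                ((torusLocalComponent L (IsCMField.complexConj L) v ξ.η).comp
                    (quotConj (conjLocal L (IsCMField.complexConj L) v) (conjLocal_conjLocal_cm L v)) *
                  halfModulusChar (UnitaryGroup.LocalRing L v))
                (torusLocalComponent L (IsCMField.complexConj L) v ξ.ψ))
              ((torusLocalComponent L (IsCMField.complexConj L) v ξ.ψ).comp (localDet (IsCMField.complexConj L) v (isUnit_antidiagOne_det L 1))) π₁ πSt →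
            (∀ fH : ((UnitaryGroup.cmDatum L 2 (Matrix.of fun i j : Fin 2 => if i.val + j.val + 1 = 2 then (1 : L) else 0)).Local v × (UnitaryGroup.cmDatum L 1 (Matrix.of fun i j : Fin 1 => if i.val + j.val + 1 = 1 then (1 : L) else 0)).Local v) → ℂ, IsLocSmooth fH → π₁.smoothTrace νHv fH = charDist (ξ.xiLocalChar v) νHv fH) →
          -- ══ the §12.5 datum (over the organ's Borel σ-algebra on `U(Φ₃)(L⁺_v) ⧸ Z`) and the package conjuncts consumed (COMPAT `hμG hμH hreg hTr hρ`; carpet `UpSpec`; sockets (M1H) (UPR)) ══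
          ∀ [MeasurableSpace (Gqs L v ⧸ Subgroup.center (Gqs L v))] [BorelSpace (Gqs L v ⧸ Subgroup.center (Gqs L v))],
          ∀ (𝔇 : Ch12Sec5.EllipticData (Gqs L v) ((UnitaryGroup.cmDatum L 2 (Matrix.of fun i j : Fin 2 => if i.val + j.val + 1 = 2 then (1 : L) else 0)).Local v × (UnitaryGroup.cmDatum L 1 (Matrix.of fun i j : Fin 1 => if i.val + j.val + 1 = 1 then (1 : L) else 0)).Local v)),
            𝔇.μG = νQv → 𝔇.μH = νHv →
            (∀ γ : Gqs L v, γ ∈ 𝔇.regG ↔ IsRegularElt (γ.val : GL (Fin 3) (UnitaryGroup.LocalRing L v))) →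
            (∀ (φ : Gqs L v → ℂ) (fH : ((UnitaryGroup.cmDatum L 2 (Matrix.of fun i j : Fin 2 => if i.val + j.val + 1 = 2 then (1 : L) else 0)).Local v × (UnitaryGroup.cmDatum L 1 (Matrix.of fun i j : Fin 1 => if i.val + j.val + 1 = 1 then (1 : L) else 0)).Local v) → ℂ), 𝔇.IsTransfer φ fH ↔ IsLocalDeltaTransfer L (qsForm L) v ((finExplicitCollection L (qsForm L) μ (finExplicitDelta_conj_left_all L (qsForm L) μ) (finExplicitDelta_conj_right_all L (qsForm L) μ)) v) mHv mQv fH φ) →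
            ({πSt} : Finset (IrrClass ((UnitaryGroup.cmDatum L 2 (Matrix.of fun i j : Fin 2 => if i.val + j.val + 1 = 2 then (1 : L) else 0)).Local v × (UnitaryGroup.cmDatum L 1 (Matrix.of fun i j : Fin 1 => if i.val + j.val + 1 = 1 then (1 : L) else 0)).Local v))) ∈ 𝔇.sqPacketsH →
            𝔇.UpSpec → 𝔇.PacketCharHRegularity → 𝔇.UpRegularity →
          -- ══ (DEC-up) of the (TOR⁶) block of the leaf's (S-𝔇) organ, BYTE FOR BYTE ══
          (∃ C s : ℝ, 0 < s ∧ ∀ m : ((LocalRing L v)ˣ × ↥(normOneUnits (conjLocal L (IsCMField.complexConj L) v))), m ∉ (((Submonoid.pi Set.univ (fun w : PlacesOver L v => (w.1.adicCompletionIntegers L).toSubring.toSubmonoid)).units.prod (⊤ : Subgroup ↥(normOneUnits (conjLocal L (IsCMField.complexConj L) v)))) : Subgroup ((LocalRing L v)ˣ × ↥(normOneUnits (conjLocal L (IsCMField.complexConj L) v)))) →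
            ‖(((vanDijkWeight L v (torusChart L v m)).re : ℝ) : ℂ) * 𝔇.up (𝔇.packetCharH {πSt}) (((torusChart L v m : ↥(cmBorelTriple L 3 v).M) : ↥(unitaryGroupOfForm (conjLocal L (IsCMField.complexConj L) v) (cmLocalForm L 3 v))) : Gqs L v)‖ ≤ C * (min ((unitModulusChar (LocalRing L v) m.1 : NNReal) : ℝ) ((unitModulusChar (LocalRing L v) m.1 : NNReal) : ℝ)⁻¹) ^ s) := by
  intro L _ _ _ μ ξ v hns hμu hμω _ _ _ _ νHv νQv _ _ _ _ mHv mQv hcH hcQ hTv π₁ πSt hlab hπ₁ _ _ 𝔇 hμG hμH hreg hTr hρ hUp hHCH hUpReg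
  -- the organ's Borel quotient σ-algebras, re-installed as local instances (as in ★ ₄ ∕ ★ UP-VALUE)
  letI : ∀ γ : Gqs L v, MeasurableSpace (Gqs L v ⧸ Subgroup.centralizer ({γ} : Set (Gqs L v))) := fun _ => borel _
  haveI : ∀ γ : Gqs L v, BorelSpace (Gqs L v ⧸ Subgroup.centralizer ({γ} : Set (Gqs L v))) := fun _ => ⟨rfl⟩
  haveI := locallyCompactSpace_cmBorelU L 3 v
  obtain ⟨w⟩ : Nonempty (PlacesOver L v) := inferInstance
  have hw : IsCMField.complexConj L • w.1 = w.1 := hns w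
  haveI := PlacesOver.subsingleton_of_smul_eq (IsCMField.complexConj L) (IsCMField.complexConj_ne_one L) w hw
  -- `χ_ρ^G` is a class function at the regular elements (`UpSpec` + COMPAT `hreg`)
  obtain ⟨hmeasH, -, hstH, -, -⟩ := hHCH {πSt} hρ
  obtain ⟨-, hclU, -⟩ := hUp (𝔇.packetCharH {πSt}) hmeasH hstH
  have hΘcl : ∀ g : Gqs L v, IsRegularElt (g.val : GL (Fin 3) (LocalRing L v)) → ∀ h : Gqs L v,
      𝔇.up (𝔇.packetCharH {πSt}) (h * g * h⁻¹) = 𝔇.up (𝔇.packetCharH {πSt}) g :=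
    fun g hg h => hclU g ((hreg g).2 hg) h
  refine ⟨1, 1 / 2, one_half_pos, F0P3cStCharTSDecSigma.shellDecay_of_dominant_half L v hns w _ hΘcl fun m hm hlt => ?_⟩
  -- ═══ the dominant half: `ι m = z·a` (§2), a datum along `a` (★ T1), and ★ UP-VALUE at `z·𝓘.a¹ = ι m` ═══
  obtain ⟨z, a, α, hzc, hα0, hα1, ha, hza⟩ := exists_central_mul_ray_eq_torusChart L v w hw m hlt
  obtain ⟨𝓘, K₀, h𝓘a, hK₀c, hK₀o, hZK₀, hKK₀, hnormK₀, haN, haNbar, hexh, huniq, hdisj, hK₀E⟩ :=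
    F0P3CMBorelIwahoriDatum.exists_cmIwahoriDatum L v w hw a hα0 hα1 ha
  have ha' : ((((localNonsplitEquiv (IsCMField.complexConj L) (Rogawski1990.qsForm L) (IsCMField.complexConj_ne_one L) w hw) 𝓘.a :
      ↥(unitaryGroupOfForm (galAdicCompletionMap (L := L) (IsCMField.complexConj L) hw) (placeForm (Rogawski1990.qsForm L) w.1))) :
      GL (Fin 3) (w.1.adicCompletion L)) : Matrix (Fin 3) (Fin 3) (w.1.adicCompletion L)) =
        Matrix.diagonal ![α, 1, ((galAdicCompletionMap (L := L) (IsCMField.complexConj L) hw) α)⁻¹] := by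
    rw [h𝓘a]; exact ha
  have hb : ((torusChart L v m : ↥(cmBorelTriple L 3 v).M) : ↥(unitaryGroupOfForm (conjLocal L (IsCMField.complexConj L) v) (cmLocalForm L 3 v))) = z * 𝓘.a ^ 1 := by
    rw [pow_one, h𝓘a]; exact hza
  -- ★ UP-VALUE, read at the subtype point `ι m` (destructure, substitute, apply — no rewriting across the two torus spellings)
  have key : ∀ (t : ↥(cmBorelTriple L 3 v).M), ((t : ↥(unitaryGroupOfForm (conjLocal L (IsCMField.complexConj L) v) (cmLocalForm L 3 v))) = z * 𝓘.a ^ 1) →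
      𝔇.up (𝔇.packetCharH {πSt}) (((t : ↥(cmBorelTriple L 3 v).M) : ↥(unitaryGroupOfForm (conjLocal L (IsCMField.complexConj L) v) (cmLocalForm L 3 v))) : Gqs L v) =
        ((rootDeltaChar (cmBorelTriple L 3 v).P (Subgroup.inclusion (cmBorelTriple L 3 v).M_le t) : ℂˣ) : ℂ) *
          (((cmXiTorusChar L v (μ.semilocalComponent L v) (torusLocalComponent L (IsCMField.complexConj L) v ξ.η)
              (torusLocalComponent L (IsCMField.complexConj L) v ξ.ψ)) t : ℂˣ) : ℂ) := by
    rintro ⟨t, htM⟩ ht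
    change t = z * 𝓘.a ^ 1 at ht
    subst ht
    exact F0P3cStCharTSUpValue.up_packetCharH_central_mul_ray_pow L μ ξ v hns hμu hμω νHv νQv mHv mQv hcH hcQ hTv π₁ πSt hlab hπ₁
      𝔇 hμG hμH hreg hTr hρ hUp hHCH hUpReg 𝓘 z hzc w hw α hα0 hα1 ha' K₀ hK₀c hK₀o hZK₀ hKK₀ hnormK₀ haN haNbar hexh huniq hdisj hK₀E 1 le_rfl htM
  rw [key (torusChart L v m) hb]
  -- ═══ norms: `Δ(ι m) = ‖m.1‖⁻¹`, `|δ_B^{1/2}(ι m)| = ‖m.1‖`, `|χ_{ξ,μ}(ι m)| = ‖m.1‖^{1/2}` ═══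
  have hq1 : unitModulusChar (LocalRing L v) m.1 < 1 :=
    unitModulusChar_lt_one_of_forall_v_lt_one L v m.1 fun w' => by rw [Subsingleton.elim w' w]; exact hlt
  have hq0 : unitModulusChar (LocalRing L v) m.1 ≠ 0 := F0P3cStCharTSL1MSplit.unitModulusChar_ne_zero L v m.1
  have hQ0 : (0 : ℝ) < ((unitModulusChar (LocalRing L v) m.1 : ℝ≥0) : ℝ) := NNReal.coe_pos.2 (pos_iff_ne_zero.2 hq0)
  have hQ1 : ((unitModulusChar (LocalRing L v) m.1 : ℝ≥0) : ℝ) < 1 := by exact_mod_cast hq1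
  have hQle : ((unitModulusChar (LocalRing L v) m.1 : ℝ≥0) : ℝ) ≤ ((unitModulusChar (LocalRing L v) m.1 : ℝ≥0) : ℝ)⁻¹ :=
    hQ1.le.trans ((one_le_inv₀ hQ0).2 hQ1.le)
  have hΔ : ((vanDijkWeight L v (torusChart L v m)).re : ℝ) = (((unitModulusChar (LocalRing L v) m.1)⁻¹ : ℝ≥0) : ℝ) := by
    rw [F0P3cStCharTSShellWeight.vanDijkWeight_torusChart_of_not_mem L v hns m hm, Complex.ofReal_re,
      max_eq_right (hq1.le.trans ((one_le_inv₀ (pos_iff_ne_zero.2 hq0)).2 hq1.le))]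
  have hδ : ((rootDeltaChar (cmBorelTriple L 3 v).P (Subgroup.inclusion (cmBorelTriple L 3 v).M_le (torusChart L v m)) : ℂˣ) : ℂ) =
      ((unitModulusChar (LocalRing L v) m.1 : ℝ≥0) : ℝ) := by
    have h := F0P2oBorelTorusModulus.rootDeltaChar_cmBorel_torus L v (torusChart L v m)
    rw [torusEntry_zero_torusChart] at h
    exact h
  have hχ : ‖(((cmXiTorusChar L v (μ.semilocalComponent L v) (torusLocalComponent L (IsCMField.complexConj L) v ξ.η)
      (torusLocalComponent L (IsCMField.complexConj L) v ξ.ψ)) (torusChart L v m) : ℂˣ) : ℂ)‖ =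
        Real.sqrt ((unitModulusChar (LocalRing L v) m.1 : ℝ≥0) : ℝ) := by
    rw [cmXiTorusChar_apply, Units.val_mul, Units.val_mul, Units.val_mul, norm_mul, norm_mul, norm_mul,
      cm_norm_torusLocalComponent_eq_one L ξ.η ξ.hη, cm_norm_torusLocalComponent_eq_one L ξ.ψ ξ.hψ, semilocalComponent_apply, hμu,
      coe_halfModulusChar_apply, Complex.norm_real, Real.norm_eq_abs, abs_of_nonneg (NNReal.coe_nonneg _), torusEntry_zero_torusChart, Real.coe_sqrt]
    ring
  have hnorm : ‖(((vanDijkWeight L v (torusChart L v m)).re : ℝ) : ℂ) *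
      (((rootDeltaChar (cmBorelTriple L 3 v).P (Subgroup.inclusion (cmBorelTriple L 3 v).M_le (torusChart L v m)) : ℂˣ) : ℂ) *
        (((cmXiTorusChar L v (μ.semilocalComponent L v) (torusLocalComponent L (IsCMField.complexConj L) v ξ.η)
            (torusLocalComponent L (IsCMField.complexConj L) v ξ.ψ)) (torusChart L v m) : ℂˣ) : ℂ))‖ =
      Real.sqrt ((unitModulusChar (LocalRing L v) m.1 : ℝ≥0) : ℝ) := by
    rw [norm_mul, norm_mul, Complex.norm_real, Real.norm_eq_abs, hΔ, hδ, Complex.norm_real, Real.norm_eq_abs, hχ,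
      abs_of_nonneg (NNReal.coe_nonneg _), abs_of_nonneg (NNReal.coe_nonneg _), NNReal.coe_inv, ← mul_assoc,
      inv_mul_cancel₀ hQ0.ne', one_mul]
  rw [hnorm, one_mul, min_eq_left hQle, ← Real.sqrt_eq_rpow]

/-! ## §4 (ED. 2) The `_LB` twin of §3 — (DEC-up) from the LOCALLY-BOUNDED carpet reading ★ `UpSpecLB` + Harish-Chandra's bound on `H` at `ρ` -/

set_option maxHeartbeats 16000000 in
set_option synthInstance.maxHeartbeats 400000 in
-- the statement's binders (the organ prefix + the datum block) and the cross-spelling `exact`s (measured class, as ★ UP-VALUE ∕ ★ DEC-SIGMA)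
/-- **«DEC-UP★», `_LB` twin (ROAD «UP-TR» DEAL #4 (D4-6); guard γ: ★ `decUp_of_package` untouched)** — the (DEC-up) clause of the (TOR⁶) block, witnesses `C = 1`, `s = 1∕2`,
with the carpet hypothesis WEAKENED to ★ `UpSpecLB` (★ p852414) plus the local-boundedness antecedent at `α = χ_ρ`, `ρ = {πSt}` (`∀ C` compact `∃ B`, `‖D_H(s)·χ_ρ(s)‖ ≤ B` on
`C ∩ H^r` — the junction's ★ `hHBHP` pin) as ONE extra binder right after it; every other binder and the conclusion = ★ DEC-UP token for token.  Body = ★'s by paste, reading the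
value through the `_LB` twin ★ `F0P3cStCharTSUpValue.up_packetCharH_central_mul_ray_pow_LB` (clause 2 «class function on `G^r`» is unconditional in `UpSpecLB`).
[cite: Rogawski1990, §12.7 Lemma 12.7.2 (proof) p. 193; §12.5 Lemma 12.5.1 p. 183; §12.2 p. 173] -/
theorem decUp_of_package_LB :
      ∀ (L : Type) [Field L] [NumberField L] [IsCMField L] (μ : HeckeCharacter L) (ξ : OneDimAutRepH L) (v : HeightOneSpectrum (𝓞 ↥(maximalRealSubfield L))),
        (∀ w : PlacesOver L v, IsCMField.complexConj L • w.1 = w.1) → μ.IsUnitary →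
        (∀ x : Literature.NumberTheory.GaloisRepresentations.ideleGroup ↥(maximalRealSubfield L),
          μ (AdeleRing.ideleBaseChange (↥(maximalRealSubfield L)) L x) = quadraticHeckeCharCM L x) →
        ∀ [MeasurableSpace (((UnitaryGroup.cmDatum L 2 (Matrix.of fun i j : Fin 2 => if i.val + j.val + 1 = 2 then (1 : L) else 0)).Local v × (UnitaryGroup.cmDatum L 1 (Matrix.of fun i j : Fin 1 => if i.val + j.val + 1 = 1 then (1 : L) else 0)).Local v))] [BorelSpace (((UnitaryGroup.cmDatum L 2 (Matrix.of fun i j : Fin 2 => if i.val + j.val + 1 = 2 then (1 : L) else 0)).Local v × (UnitaryGroup.cmDatum L 1 (Matrix.of fun i j : Fin 1 => if i.val + j.val + 1 = 1 then (1 : L) else 0)).Local v))] [MeasurableSpace (Gqs L v)] [BorelSpace (Gqs L v)]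
          (νHv : Measure (((UnitaryGroup.cmDatum L 2 (Matrix.of fun i j : Fin 2 => if i.val + j.val + 1 = 2 then (1 : L) else 0)).Local v × (UnitaryGroup.cmDatum L 1 (Matrix.of fun i j : Fin 1 => if i.val + j.val + 1 = 1 then (1 : L) else 0)).Local v))) (νQv : Measure (Gqs L v))
          [νHv.IsHaarMeasure] [νHv.IsMulRightInvariant] [νQv.IsHaarMeasure] [νQv.IsMulRightInvariant],
        letI : ∀ a : ((UnitaryGroup.cmDatum L 2 (Matrix.of fun i j : Fin 2 => if i.val + j.val + 1 = 2 then (1 : L) else 0)).Local v × (UnitaryGroup.cmDatum L 1 (Matrix.of fun i j : Fin 1 => if i.val + j.val + 1 = 1 then (1 : L) else 0)).Local v), MeasurableSpace (((UnitaryGroup.cmDatum L 2 (Matrix.of fun i j : Fin 2 => if i.val + j.val + 1 = 2 then (1 : L) else 0)).Local v × (UnitaryGroup.cmDatum L 1 (Matrix.of fun i j : Fin 1 => if i.val + j.val + 1 = 1 then (1 : L) else 0)).Local v) ⧸ Subgroup.centralizer ({a} : Set (((UnitaryGroup.cmDatum L 2 (Matrix.of fun i j : Fin 2 => if i.val + j.val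 + 1 = 2 then (1 : L) else 0)).Local v × (UnitaryGroup.cmDatum L 1 (Matrix.of fun i j : Fin 1 => if i.val + j.val + 1 = 1 then (1 : L) else 0)).Local v)))) := fun _ => borel _
        haveI : ∀ a : ((UnitaryGroup.cmDatum L 2 (Matrix.of fun i j : Fin 2 => if i.val + j.val + 1 = 2 then (1 : L) else 0)).Local v × (UnitaryGroup.cmDatum L 1 (Matrix.of fun i j : Fin 1 => if i.val + j.val + 1 = 1 then (1 : L) else 0)).Local v), BorelSpace (((UnitaryGroup.cmDatum L 2 (Matrix.of fun i j : Fin 2 => if i.val + j.val + 1 = 2 then (1 : L) else 0)).Local v × (UnitaryGroup.cmDatum L 1 (Matrix.of fun i j : Fin 1 => if i.val + j.val + 1 = 1 then (1 : L) else 0)).Local v) ⧸ Subgroup.centralizer ({a} : Set (((UnitaryGroup.cmDatum L 2 (Matrix.of fun i j : Fin 2 => if i.val + j.val + 1 = 2 then (1 : L) else 0)).Local v × (UnitaryGroup.cmDatum L 1 (Matrix.of fun i j : Fin 1 => if i.val + j.val + 1 = 1 then (1 : L) else 0)).Local v)))) := fun _ => ⟨rfl⟩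
        letI : ∀ γ : Gqs L v, MeasurableSpace (Gqs L v ⧸ Subgroup.centralizer ({γ} : Set (Gqs L v))) := fun _ => borel _
        haveI : ∀ γ : Gqs L v, BorelSpace (Gqs L v ⧸ Subgroup.centralizer ({γ} : Set (Gqs L v))) := fun _ => ⟨rfl⟩
        ∀ (mHv : OrbitalMeasureFamily (((UnitaryGroup.cmDatum L 2 (Matrix.of fun i j : Fin 2 => if i.val + j.val + 1 = 2 then (1 : L) else 0)).Local v × (UnitaryGroup.cmDatum L 1 (Matrix.of fun i j : Fin 1 => if i.val + j.val + 1 = 1 then (1 : L) else 0)).Local v))) (mQv : OrbitalMeasureFamily (Gqs L v)),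
          mHv.IsCanonical (IsLocalGRegular L v) νHv →
          mQv.IsCanonical (fun γ => IsRegularElt (γ.val : GL (Fin 3) (UnitaryGroup.LocalRing L v))) νQv →
          IsLocalDeltaTransferExists L (qsForm L) v ((finExplicitCollection L (qsForm L) μ (finExplicitDelta_conj_left_all L (qsForm L) μ) (finExplicitDelta_conj_right_all L (qsForm L) μ)) v) mHv mQv IsLocSmooth IsLocSmooth →
          ∀ (π₁ πSt : IrrClass (((UnitaryGroup.cmDatum L 2 (Matrix.of fun i j : Fin 2 => if i.val + j.val + 1 = 2 then (1 : L) else 0)).Local v × (UnitaryGroup.cmDatum L 1 (Matrix.of fun i j : Fin 1 => if i.val + j.val + 1 = 1 then (1 : L) else 0)).Local v))),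
            HLengthTwoLabels L v
              (torusCharPair (conjLocal L (IsCMField.complexConj L) v) (cmLocalForm L 2 v) (cmLocalForm_eq_over L 2 v) 0
                ((torusLocalComponent L (IsCMField.complexConj L) v ξ.η).comp
                    (quotConj (conjLocal L (IsCMField.complexConj L) v) (conjLocal_conjLocal_cm L v)) *
                  halfModulusChar (UnitaryGroup.LocalRing L v))
                (torusLocalComponent L (IsCMField.complexConj L) v ξ.ψ))
              ((torusLocalComponent L (IsCMField.complexConj L) v ξ.ψ).comp (localDet (IsCMField.complexConj L) v (isUnit_antidiagOne_det L 1))) π₁ πSt →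
            (∀ fH : ((UnitaryGroup.cmDatum L 2 (Matrix.of fun i j : Fin 2 => if i.val + j.val + 1 = 2 then (1 : L) else 0)).Local v × (UnitaryGroup.cmDatum L 1 (Matrix.of fun i j : Fin 1 => if i.val + j.val + 1 = 1 then (1 : L) else 0)).Local v) → ℂ, IsLocSmooth fH → π₁.smoothTrace νHv fH = charDist (ξ.xiLocalChar v) νHv fH) →
          -- ══ the §12.5 datum (over the organ's Borel σ-algebra on `U(Φ₃)(L⁺_v) ⧸ Z`) and the package conjuncts consumed (COMPAT `hμG hμH hreg hTr hρ`; carpet `UpSpec`; sockets (M1H) (UPR)) ══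
          ∀ [MeasurableSpace (Gqs L v ⧸ Subgroup.center (Gqs L v))] [BorelSpace (Gqs L v ⧸ Subgroup.center (Gqs L v))],
          ∀ (𝔇 : Ch12Sec5.EllipticData (Gqs L v) ((UnitaryGroup.cmDatum L 2 (Matrix.of fun i j : Fin 2 => if i.val + j.val + 1 = 2 then (1 : L) else 0)).Local v × (UnitaryGroup.cmDatum L 1 (Matrix.of fun i j : Fin 1 => if i.val + j.val + 1 = 1 then (1 : L) else 0)).Local v)),
            𝔇.μG = νQv → 𝔇.μH = νHv →
            (∀ γ : Gqs L v, γ ∈ 𝔇.regG ↔ IsRegularElt (γ.val : GL (Fin 3) (UnitaryGroup.LocalRing L v))) →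
            (∀ (φ : Gqs L v → ℂ) (fH : ((UnitaryGroup.cmDatum L 2 (Matrix.of fun i j : Fin 2 => if i.val + j.val + 1 = 2 then (1 : L) else 0)).Local v × (UnitaryGroup.cmDatum L 1 (Matrix.of fun i j : Fin 1 => if i.val + j.val + 1 = 1 then (1 : L) else 0)).Local v) → ℂ), 𝔇.IsTransfer φ fH ↔ IsLocalDeltaTransfer L (qsForm L) v ((finExplicitCollection L (qsForm L) μ (finExplicitDelta_conj_left_all L (qsForm L) μ) (finExplicitDelta_conj_right_all L (qsForm L) μ)) v) mHv mQv fH φ) →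
            ({πSt} : Finset (IrrClass ((UnitaryGroup.cmDatum L 2 (Matrix.of fun i j : Fin 2 => if i.val + j.val + 1 = 2 then (1 : L) else 0)).Local v × (UnitaryGroup.cmDatum L 1 (Matrix.of fun i j : Fin 1 => if i.val + j.val + 1 = 1 then (1 : L) else 0)).Local v))) ∈ 𝔇.sqPacketsH →
            𝔇.UpSpecLB →
            (∀ C : Set ((UnitaryGroup.cmDatum L 2 (Matrix.of fun i j : Fin 2 => if i.val + j.val + 1 = 2 then (1 : L) else 0)).Local v × (UnitaryGroup.cmDatum L 1 (Matrix.of fun i j : Fin 1 => if i.val + j.val + 1 = 1 then (1 : L) else 0)).Local v), IsCompact C → ∃ B : ℝ, ∀ s ∈ C, s ∈ 𝔇.regH → ‖(𝔇.DH s : ℂ) * 𝔇.packetCharH {πSt} s‖ ≤ B) →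
            𝔇.PacketCharHRegularity → 𝔇.UpRegularity →
          -- ══ (DEC-up) of the (TOR⁶) block of the leaf's (S-𝔇) organ, BYTE FOR BYTE ══
          (∃ C s : ℝ, 0 < s ∧ ∀ m : ((LocalRing L v)ˣ × ↥(normOneUnits (conjLocal L (IsCMField.complexConj L) v))), m ∉ (((Submonoid.pi Set.univ (fun w : PlacesOver L v => (w.1.adicCompletionIntegers L).toSubring.toSubmonoid)).units.prod (⊤ : Subgroup ↥(normOneUnits (conjLocal L (IsCMField.complexConj L) v)))) : Subgroup ((LocalRing L v)ˣ × ↥(normOneUnits (conjLocal L (IsCMField.complexConj L) v)))) →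
            ‖(((vanDijkWeight L v (torusChart L v m)).re : ℝ) : ℂ) * 𝔇.up (𝔇.packetCharH {πSt}) (((torusChart L v m : ↥(cmBorelTriple L 3 v).M) : ↥(unitaryGroupOfForm (conjLocal L (IsCMField.complexConj L) v) (cmLocalForm L 3 v))) : Gqs L v)‖ ≤ C * (min ((unitModulusChar (LocalRing L v) m.1 : NNReal) : ℝ) ((unitModulusChar (LocalRing L v) m.1 : NNReal) : ℝ)⁻¹) ^ s) := by
  intro L _ _ _ μ ξ v hns hμu hμω _ _ _ _ νHv νQv _ _ _ _ mHv mQv hcH hcQ hTv π₁ πSt hlab hπ₁ _ _ 𝔇 hμG hμH hreg hTr hρ hUp hρB hHCH hUpReg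
  -- the organ's Borel quotient σ-algebras, re-installed as local instances (as in ★ ₄ ∕ ★ UP-VALUE)
  letI : ∀ γ : Gqs L v, MeasurableSpace (Gqs L v ⧸ Subgroup.centralizer ({γ} : Set (Gqs L v))) := fun _ => borel _
  haveI : ∀ γ : Gqs L v, BorelSpace (Gqs L v ⧸ Subgroup.centralizer ({γ} : Set (Gqs L v))) := fun _ => ⟨rfl⟩
  haveI := locallyCompactSpace_cmBorelU L 3 v
  obtain ⟨w⟩ : Nonempty (PlacesOver L v) := inferInstance
  have hw : IsCMField.complexConj L • w.1 = w.1 := hns w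
  haveI := PlacesOver.subsingleton_of_smul_eq (IsCMField.complexConj L) (IsCMField.complexConj_ne_one L) w hw
  -- `χ_ρ^G` is a class function at the regular elements (`UpSpecLB` clause 2 + COMPAT `hreg`)
  obtain ⟨hmeasH, -, hstH, -, -⟩ := hHCH {πSt} hρ
  obtain ⟨-, hclU, -⟩ := hUp (𝔇.packetCharH {πSt}) hmeasH hstH
  have hΘcl : ∀ g : Gqs L v, IsRegularElt (g.val : GL (Fin 3) (LocalRing L v)) → ∀ h : Gqs L v,
      𝔇.up (𝔇.packetCharH {πSt}) (h * g * h⁻¹) = 𝔇.up (𝔇.packetCharH {πSt}) g :=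
    fun g hg h => hclU g ((hreg g).2 hg) h
  refine ⟨1, 1 / 2, one_half_pos, F0P3cStCharTSDecSigma.shellDecay_of_dominant_half L v hns w _ hΘcl fun m hm hlt => ?_⟩
  -- ═══ the dominant half: `ι m = z·a` (§2), a datum along `a` (★ T1), and ★ UP-VALUE at `z·𝓘.a¹ = ι m` ═══
  obtain ⟨z, a, α, hzc, hα0, hα1, ha, hza⟩ := exists_central_mul_ray_eq_torusChart L v w hw m hlt
  obtain ⟨𝓘, K₀, h𝓘a, hK₀c, hK₀o, hZK₀, hKK₀, hnormK₀, haN, haNbar, hexh, huniq, hdisj, hK₀E⟩ :=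
    F0P3CMBorelIwahoriDatum.exists_cmIwahoriDatum L v w hw a hα0 hα1 ha
  have ha' : ((((localNonsplitEquiv (IsCMField.complexConj L) (Rogawski1990.qsForm L) (IsCMField.complexConj_ne_one L) w hw) 𝓘.a :
      ↥(unitaryGroupOfForm (galAdicCompletionMap (L := L) (IsCMField.complexConj L) hw) (placeForm (Rogawski1990.qsForm L) w.1))) :
      GL (Fin 3) (w.1.adicCompletion L)) : Matrix (Fin 3) (Fin 3) (w.1.adicCompletion L)) =
        Matrix.diagonal ![α, 1, ((galAdicCompletionMap (L := L) (IsCMField.complexConj L) hw) α)⁻¹] := by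
    rw [h𝓘a]; exact ha
  have hb : ((torusChart L v m : ↥(cmBorelTriple L 3 v).M) : ↥(unitaryGroupOfForm (conjLocal L (IsCMField.complexConj L) v) (cmLocalForm L 3 v))) = z * 𝓘.a ^ 1 := by
    rw [pow_one, h𝓘a]; exact hza
  -- ★ UP-VALUE (`_LB` twin), read at the subtype point `ι m` (destructure, substitute, apply — no rewriting across the two torus spellings)
  have key : ∀ (t : ↥(cmBorelTriple L 3 v).M), ((t : ↥(unitaryGroupOfForm (conjLocal L (IsCMField.complexConj L) v) (cmLocalForm L 3 v))) = z * 𝓘.a ^ 1) →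
      𝔇.up (𝔇.packetCharH {πSt}) (((t : ↥(cmBorelTriple L 3 v).M) : ↥(unitaryGroupOfForm (conjLocal L (IsCMField.complexConj L) v) (cmLocalForm L 3 v))) : Gqs L v) =
        ((rootDeltaChar (cmBorelTriple L 3 v).P (Subgroup.inclusion (cmBorelTriple L 3 v).M_le t) : ℂˣ) : ℂ) *
          (((cmXiTorusChar L v (μ.semilocalComponent L v) (torusLocalComponent L (IsCMField.complexConj L) v ξ.η)
              (torusLocalComponent L (IsCMField.complexConj L) v ξ.ψ)) t : ℂˣ) : ℂ) := by
    rintro ⟨t, htM⟩ ht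
    change t = z * 𝓘.a ^ 1 at ht
    subst ht
    exact F0P3cStCharTSUpValue.up_packetCharH_central_mul_ray_pow_LB L μ ξ v hns hμu hμω νHv νQv mHv mQv hcH hcQ hTv π₁ πSt hlab hπ₁
      𝔇 hμG hμH hreg hTr hρ hUp hρB hHCH hUpReg 𝓘 z hzc w hw α hα0 hα1 ha' K₀ hK₀c hK₀o hZK₀ hKK₀ hnormK₀ haN haNbar hexh huniq hdisj hK₀E 1 le_rfl htM
  rw [key (torusChart L v m) hb]
  -- ═══ norms: `Δ(ι m) = ‖m.1‖⁻¹`, `|δ_B^{1/2}(ι m)| = ‖m.1‖`, `|χ_{ξ,μ}(ι m)| = ‖m.1‖^{1/2}` ═══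
  have hq1 : unitModulusChar (LocalRing L v) m.1 < 1 :=
    unitModulusChar_lt_one_of_forall_v_lt_one L v m.1 fun w' => by rw [Subsingleton.elim w' w]; exact hlt
  have hq0 : unitModulusChar (LocalRing L v) m.1 ≠ 0 := F0P3cStCharTSL1MSplit.unitModulusChar_ne_zero L v m.1
  have hQ0 : (0 : ℝ) < ((unitModulusChar (LocalRing L v) m.1 : ℝ≥0) : ℝ) := NNReal.coe_pos.2 (pos_iff_ne_zero.2 hq0)
  have hQ1 : ((unitModulusChar (LocalRing L v) m.1 : ℝ≥0) : ℝ) < 1 := by exact_mod_cast hq1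
  have hQle : ((unitModulusChar (LocalRing L v) m.1 : ℝ≥0) : ℝ) ≤ ((unitModulusChar (LocalRing L v) m.1 : ℝ≥0) : ℝ)⁻¹ :=
    hQ1.le.trans ((one_le_inv₀ hQ0).2 hQ1.le)
  have hΔ : ((vanDijkWeight L v (torusChart L v m)).re : ℝ) = (((unitModulusChar (LocalRing L v) m.1)⁻¹ : ℝ≥0) : ℝ) := by
    rw [F0P3cStCharTSShellWeight.vanDijkWeight_torusChart_of_not_mem L v hns m hm, Complex.ofReal_re,
      max_eq_right (hq1.le.trans ((one_le_inv₀ (pos_iff_ne_zero.2 hq0)).2 hq1.le))]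
  have hδ : ((rootDeltaChar (cmBorelTriple L 3 v).P (Subgroup.inclusion (cmBorelTriple L 3 v).M_le (torusChart L v m)) : ℂˣ) : ℂ) =
      ((unitModulusChar (LocalRing L v) m.1 : ℝ≥0) : ℝ) := by
    have h := F0P2oBorelTorusModulus.rootDeltaChar_cmBorel_torus L v (torusChart L v m)
    rw [torusEntry_zero_torusChart] at h
    exact h
  have hχ : ‖(((cmXiTorusChar L v (μ.semilocalComponent L v) (torusLocalComponent L (IsCMField.complexConj L) v ξ.η)
      (torusLocalComponent L (IsCMField.complexConj L) v ξ.ψ)) (torusChart L v m) : ℂˣ) : ℂ)‖ =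
        Real.sqrt ((unitModulusChar (LocalRing L v) m.1 : ℝ≥0) : ℝ) := by
    rw [cmXiTorusChar_apply, Units.val_mul, Units.val_mul, Units.val_mul, norm_mul, norm_mul, norm_mul,
      cm_norm_torusLocalComponent_eq_one L ξ.η ξ.hη, cm_norm_torusLocalComponent_eq_one L ξ.ψ ξ.hψ, semilocalComponent_apply, hμu,
      coe_halfModulusChar_apply, Complex.norm_real, Real.norm_eq_abs, abs_of_nonneg (NNReal.coe_nonneg _), torusEntry_zero_torusChart, Real.coe_sqrt]
    ring
  have hnorm : ‖(((vanDijkWeight L v (torusChart L v m)).re : ℝ) : ℂ) *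
      (((rootDeltaChar (cmBorelTriple L 3 v).P (Subgroup.inclusion (cmBorelTriple L 3 v).M_le (torusChart L v m)) : ℂˣ) : ℂ) *
        (((cmXiTorusChar L v (μ.semilocalComponent L v) (torusLocalComponent L (IsCMField.complexConj L) v ξ.η)
            (torusLocalComponent L (IsCMField.complexConj L) v ξ.ψ)) (torusChart L v m) : ℂˣ) : ℂ))‖ =
      Real.sqrt ((unitModulusChar (LocalRing L v) m.1 : ℝ≥0) : ℝ) := by
    rw [norm_mul, norm_mul, Complex.norm_real, Real.norm_eq_abs, hΔ, hδ, Complex.norm_real, Real.norm_eq_abs, hχ,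
      abs_of_nonneg (NNReal.coe_nonneg _), abs_of_nonneg (NNReal.coe_nonneg _), NNReal.coe_inv, ← mul_assoc,
      inv_mul_cancel₀ hQ0.ne', one_mul]
  rw [hnorm, one_mul, min_eq_left hQle, ← Real.sqrt_eq_rpow]

end Summit.HodgeConjecture.HodgeConjecture.Cruxes.H413.F0P3cStCharTSDecUp

end
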